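import Literature.AlgebraicGeometry.AbelianSchemes.ProjectiveOfLiftOfPolarizedFibre
import Literature.AlgebraicGeometry.AbelianSchemes.AbelianSchemeOverField
import Literature.AlgebraicGeometry.Motives.AbelianVarietyProjectiveChart
import Literature.AlgebraicGeometry.Morphisms.ProjectiveMorphismComposition
import Literature.AlgebraicGeometry.Morphisms.PrincipalAffineCoverOfProj
import Literature.AlgebraicGeometry.Morphisms.NilpotentThickeningCoverLift
import Literature.AlgebraicGeometry.Morphisms.AffineOfNilpotentThickening
import Literature.AlgebraicGeometry.Motives.Differentials
import Mathlib.RingTheory.Artinian.Ring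
import HarnessLib

/-!
# Polarised abelian schemes over a local base are projective; the closed fibre of an abelian scheme over an Artin local
# algebra and a principal affine cover lifted from it

Topic `Literature/AlgebraicGeometry/AbelianSchemes`; THEOREMS ONLY (no definition, no instance, no notation, no named fact,
no `sorry`).  Cell `hodgecm-mathlib` (D-0151 / FLOOR 0), programme P1b, F-11 road A, grandchild `F11LiftWithLineBundle`
(letters G1-P `stub_abelianLift` / G2-P `stub_lineBundleLiftOfSomeLift`, ruling (R42)): the two «cover» inputs of the
integrators MONO-G1 (F0P1b-p06) and MONO-G2 (F0P1b-p03).  HC_CM is proved only modulo the 7 printed citations until rung 0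
closes — nothing here bears on a summit statement.

## §1 A polarised abelian scheme over a Noetherian local `ℚ`-algebra is projective

[MumfordFogartyKirwan1994] Ch. 6 §2 Prop. 6.10 / §3 (proof of Prop. 6.15, p. 125) with [EGAIII1] Thm. 4.7.1 and [MumfordAV1970]
§16–§17: for `A → Spec R` an abelian scheme over a Noetherian LOCAL `ℚ`-algebra with a polarisation `λ : A → Â` (graph datum
`Gr`, Poincaré sheaf `𝒫`, `L^Δ(λ) = Gr^*𝒫`), the sheaf `M := L^Δ(λ)^{⊗3}` has `H¹ = 0` on every field fibre (§16, the tree's V4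
`Polarization.subsingleton_ext_one_pullback_LDelta_tensorPow'`) and embeds every geometric fibre by any spanning family of its
sections (§17 Lefschetz, the tree's `Polarization.exists_hcov_isClosedImmersion_toProj_fibre_LDelta_three`; a finite spanning family
exists by §5 Cor. 2, the tree's `Morphisms.finite_and_projective_secMod_top_of_forall_fiber`), so EGA III 4.7.1 over the local base
(the tree's `Morphisms.isProjective_of_isLocalRing_of_fibre_fieldExtension`) makes `A → Spec R` PROJECTIVE:
**`AbelianSchemeOver.Polarization.isProjective_of_isLocalRing`**.  This is the proof of the tree's «αP» engine
`isProjective_of_isBaseChangeVia_of_iso_pullback_LDelta` run at the trivial extension (no lift, `G = 𝟙`); corollaries in the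
letter's binders over `Spec (A ⧸ J)`, `A` Artin local (`isProjective_of_polarization_quotient`, `…_span_singleton`), and the finite
PRINCIPAL AFFINE COVER of `A` it yields through the tree's `Morphisms.exists_principal_affine_cover_of_isProjective`
([Hartshorne1977] II Prop. 2.5): `Polarization.exists_principal_affine_cover_of_isLocalRing`.

## §2 The closed fibre and a principal affine cover lifted from it (no polarisation)

[Hartshorne2010] Thm. 10.2 (a), proof (p. 81) / [MumfordFogartyKirwan1994] Ch. 6 §3 p. 125: for `A₀ → Spec R` an abelian
scheme and `π : R → k` a `k`-algebra retraction with nilpotent kernel (`R` Artin local with coefficient field `k`), the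
closed fibre `X := A₀ ×_R k → Spec k` is a smooth `k`-scheme — an abelian variety, hence PROJECTIVE ([MumfordAV1970] §6
Application 1 / [GortzWedhorn2023] Prop. 27.174, the tree's `AbelianVariety.isProjectiveOver_holds`) — included in `A₀` by a
closed immersion `i₀` with nilpotent kernel ideal (the tree's `Morphisms.isNilpotent_ker_of_isPullback_specMap`); a finite
principal affine cover `(U, b)` of `X` (`U j ∩ U l = D(b_{jl})`, [Hartshorne1977] II Prop. 2.5) is the trace of a principal affine
cover `(U', b')` of `A₀` ([StacksProject] Tag 06AD, the tree's `Morphisms.exists_principal_affine_cover_lift`), which covers `A₀`.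
**`AbelianSchemeOver.exists_closedFibre_principal_affine_cover`** packages these — together with the canonical `k`-, resp.
`R`-algebra structures on sections (`Motives.constToPresheaf`) — in the binder order of the MONO-G1 integrator.

## References
* [MumfordFogartyKirwan1994] D. Mumford, J. Fogarty, F. Kirwan, *Geometric Invariant Theory*, 3rd ed. (1994), Ch. 6 §2 Prop. 6.10
  (p. 121), Ch. 6 §3 Prop. 6.15 (p. 124) and its proof (p. 125).
* [EGAIII1] A. Grothendieck, EGA III (première partie), Publ. Math. IHÉS 11 (1961), Thm. 4.7.1.
* [MumfordAV1970] D. Mumford, *Abelian Varieties* (1970), §5 Cor. 2–3 (pp. 50–53), §6 Application 1 (pp. 60–61), §16, §17.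
* [Hartshorne1977] R. Hartshorne, *Algebraic Geometry*, GTM 52 (1977), II Prop. 2.5 (pp. 76–77), II §4 Definition p. 103.
* [Hartshorne2010] R. Hartshorne, *Deformation Theory*, GTM 257 (2010), Thm. 10.2 (a), proof (p. 81).
* [GortzWedhorn2023] U. Görtz, T. Wedhorn, *Algebraic Geometry II* (2023), Prop. 27.174 (p. 669).
* [GortzWedhorn2020] U. Görtz, T. Wedhorn, *Algebraic Geometry I*, 2nd ed. (2020), Section (4.7) (pp. 107–108), Prop. 4.20 (p. 104).
* [StacksProject] The Stacks Project, Tag 06AD, Tag 04EX.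
-/

noncomputable section

-- Mathlib's `Over` monoidal API and `Scheme.Modules` section API are stated across semireducible wrappers.
set_option backward.isDefEq.respectTransparency false

open CategoryTheory CategoryTheory.Limits CategoryTheory.Abelian AlgebraicGeometry TopologicalSpace Opposite
open Literature.AlgebraicGeometry.Modules Literature.AlgebraicGeometry.Motives
open Literature.AlgebraicGeometry.Motives.GeneratingSections

universe u

namespace Literature.AlgebraicGeometry.AbelianSchemes

namespace AbelianSchemeOver

/-! ## §1 Polarised abelian schemes over a Noetherian local `ℚ`-algebra are projective -/

section Polarized

variable {R : Type} [CommRing R] [Algebra ℚ R] [IsNoetherianRing R] [IsLocalRing R]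
  (A : AbelianSchemeOver (Spec (.of R))) (D : A.DualPair)

/-- **A polarised abelian scheme over a Noetherian local `ℚ`-algebra is projective** ([MumfordFogartyKirwan1994] Ch. 6 §2–§3 with
[EGAIII1] 4.7.1 over the local base at `M := L^Δ(λ)^{⊗3}`: fibrewise `H¹ = 0` by [MumfordAV1970] §16, every geometric fibre embedded by
a finite spanning family of sections of `M` by §17 (Lefschetz) and §5 Cor. 2).  The «αP» argument with no lift (`G = 𝟙`).
[cite: MumfordFogartyKirwan1994, Ch. 6 §3 Prop. 6.15 (p. 124) and its proof (p. 125)] [cite: EGAIII1, Thm. 4.7.1]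
[cite: MumfordAV1970, §16 (the vanishing theorem)] [cite: MumfordAV1970, §17 (Lefschetz theorem)] -/
theorem Polarization.isProjective_of_isLocalRing (pol : A.Polarization D) (Gr : A.X.left ⟶ A.prodLeft D.hat)
    (hGr₁ : Gr ≫ pullback.fst A.X.hom D.hat.X.hom = 𝟙 _) (hGr₂ : Gr ≫ pullback.snd A.X.hom D.hat.X.hom = pol.lam.left) :
    Morphisms.IsProjective A.X.hom := by
  classical
  haveI : IsProper A.X.hom := A.isProper
  haveI : Smooth A.X.hom := A.isSmooth
  -- `M := L^Δ(λ)^{⊗3} = (Gr^*𝒫)^{⊗3}` with a rank-one frame system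
  have hP : HasRank ((Scheme.Modules.pullback Gr).obj D.P) 1 := hasRank_pullback Gr D.hasRank_one
  obtain ⟨F, h1⟩ := exists_frameSystem_of_hasRank (hasRank_tensorPow_one hP 3)
  -- (hvan) `H¹ = 0` on every field fibre of `(A, M)` — Mumford §16 (★ V4)
  have hvan : ∀ ⦃K : Type⦄ [Field K] ⦃X₀ : Scheme.{0}⦄ (i : X₀ ⟶ A.X.left) (f₀ : X₀ ⟶ Spec (.of K))
      (x : Spec (.of K) ⟶ Spec (.of R)), IsPullback i f₀ A.X.hom x →
        Subsingleton (Ext.{1} (unitModule X₀) ((Scheme.Modules.pullback i).obj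
          (tensorPow ((Scheme.Modules.pullback Gr).obj D.P) 3)) 1) :=
    fun K _ X₀ i f₀ x H ↦ pol.subsingleton_ext_one_pullback_LDelta_tensorPow' A D Gr hGr₁ hGr₂ x H (m := 3) (by norm_num)
  -- (H) at every point of `Spec R`: the geometric fibre over `κ(t)̄`, embedded by a spanning family (Lefschetz)
  refine Morphisms.isProjective_of_isLocalRing_of_fibre_fieldExtension A.X.hom F h1 hvan fun t ↦ ?_
  haveI : CharZero ((Spec (.of R)).residueField t) :=
    Resolution.charZero_residueField_of_over_field (Spec.map (CommRingCat.ofHom (algebraMap ℚ R))) t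
  let K : Type := AlgebraicClosure ((Spec (.of R)).residueField t)
  let j : (Spec (.of R)).residueField t →+* K := algebraMap _ K
  -- the fibre `X₀ := A ×_{Spec R} Spec K`
  have HX : IsPullback (pullback.fst A.X.hom (Spec.map (CommRingCat.ofHom j) ≫ (Spec (.of R)).fromSpecResidueField t))
      (pullback.snd A.X.hom (Spec.map (CommRingCat.ofHom j) ≫ (Spec (.of R)).fromSpecResidueField t)) A.X.hom
      (Spec.map (CommRingCat.ofHom j) ≫ (Spec (.of R)).fromSpecResidueField t) := IsPullback.of_hasPullback _ _
  set iK : Spec (.of K) ⟶ Spec (.of R) := Spec.map (CommRingCat.ofHom j) ≫ (Spec (.of R)).fromSpecResidueField t with hiK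
  -- `M|_{X₀}` has `H¹ = 0` on the canonical fibres of `X₀ → Spec K` (★ V4 again): its sections form a finite `K`-module
  -- (Mumford §5 Cor. 2), whence a finite spanning family `s` (padded by `0` to `n + 1` members)
  have hvan₀ : ∀ y : Spec (.of K), Subsingleton (Ext.{1} (unitModule ((pullback.snd A.X.hom iK).fiber y))
      ((Scheme.Modules.pullback ((pullback.snd A.X.hom iK).fiberι y)).obj
        ((Scheme.Modules.pullback (pullback.fst A.X.hom iK)).obj
          (tensorPow ((Scheme.Modules.pullback Gr).obj D.P) 3))) 1) := by
    intro y
    have Hy : IsPullback ((pullback.snd A.X.hom iK).fiberι y ≫ pullback.fst A.X.hom iK)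
        ((pullback.snd A.X.hom iK).fiberToSpecResidueField y) A.X.hom
        ((Spec (.of K)).fromSpecResidueField y ≫ iK) :=
      (IsPullback.of_hasPullback (pullback.snd A.X.hom iK) ((Spec (.of K)).fromSpecResidueField y)).paste_horiz HX
    haveI := pol.subsingleton_ext_one_pullback_LDelta_tensorPow' A D Gr hGr₁ hGr₂ _ Hy (m := 3) (by norm_num)
    exact Modules.subsingleton_ext_of_iso (unitModule _)
      ((Scheme.Modules.pullbackComp ((pullback.snd A.X.hom iK).fiberι y) (pullback.fst A.X.hom iK)).app _) 1
  obtain ⟨hfin, -⟩ := Morphisms.finite_and_projective_secMod_top_of_forall_fiber (pullback.snd A.X.hom iK)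
    ((Scheme.Modules.pullback (pullback.fst A.X.hom iK)).obj (tensorPow ((Scheme.Modules.pullback Gr).obj D.P) 3))
    (F.pullback (pullback.fst A.X.hom iK)).isFiniteLocallyFree hvan₀
  haveI := hfin
  obtain ⟨n, σ, hσ⟩ := Module.Finite.exists_fin (R := Γ(Spec (.of K), ⊤))
    (M := SecMod ((Scheme.Modules.pullback (pullback.fst A.X.hom iK)).obj
      (tensorPow ((Scheme.Modules.pullback Gr).obj D.P) 3)) (pullback.snd A.X.hom iK).appTop.hom ⊤)
  let s : Fin (n + 1) → Γ((Scheme.Modules.pullback (pullback.fst A.X.hom iK)).obj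
      (tensorPow ((Scheme.Modules.pullback Gr).obj D.P) 3), ⊤) :=
    Fin.cons 0 fun l ↦ SecMod.val (ρ := (pullback.snd A.X.hom iK).appTop.hom) (σ l)
  have hs : ∀ τ : Γ((Scheme.Modules.pullback (pullback.fst A.X.hom iK)).obj
      (tensorPow ((Scheme.Modules.pullback Gr).obj D.P) 3), ⊤),
      SecMod.mk (L := (Scheme.Modules.pullback (pullback.fst A.X.hom iK)).obj
          (tensorPow ((Scheme.Modules.pullback Gr).obj D.P) 3))
        (ρ := (pullback.snd A.X.hom iK).appTop.hom) (U := ⊤) τ ∈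
        Submodule.span Γ(Spec (.of K), ⊤) (Set.range fun l ↦
          SecMod.mk (L := (Scheme.Modules.pullback (pullback.fst A.X.hom iK)).obj
            (tensorPow ((Scheme.Modules.pullback Gr).obj D.P) 3))
            (ρ := (pullback.snd A.X.hom iK).appTop.hom) (U := ⊤) (s l)) := by
    intro τ
    refine Submodule.span_mono ?_ (hσ.symm ▸ Submodule.mem_top)
    rintro _ ⟨l, rfl⟩
    exact ⟨l.succ, by simp only [s, Fin.cons_succ, SecMod.mk_val]⟩
  obtain ⟨hcov, hemb⟩ := Polarization.exists_hcov_isClosedImmersion_toProj_fibre_LDelta_three A D pol Gr hGr₁ hGr₂ F h1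
    iK s hs
  exact ⟨K, inferInstance, j, _, pullback.fst A.X.hom iK, pullback.snd A.X.hom iK, HX, _, n, s, hcov, hemb⟩

/-- **Corollary: a finite principal affine cover of a polarised abelian scheme over a Noetherian local `ℚ`-algebra** — affine opens
`U a` covering `A` with `U a ∩ U c = D(b_{ac})`, `b_{ac} ∈ Γ(A, U a)` (§1 and [Hartshorne1977] II Prop. 2.5 for projective
morphisms over an affine base, the tree's `Morphisms.exists_principal_affine_cover_of_isProjective`).
[cite: Hartshorne1977, II Prop. 2.5 (b) and proof (pp. 76–77)] [cite: MumfordFogartyKirwan1994, Ch. 6 §3 Prop. 6.15 (p. 124) and its proof (p. 125)] -/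
theorem Polarization.exists_principal_affine_cover_of_isLocalRing (pol : A.Polarization D)
    (Gr : A.X.left ⟶ A.prodLeft D.hat) (hGr₁ : Gr ≫ pullback.fst A.X.hom D.hat.X.hom = 𝟙 _)
    (hGr₂ : Gr ≫ pullback.snd A.X.hom D.hat.X.hom = pol.lam.left) :
    ∃ (ι : Type) (_ : Finite ι) (U : ι → A.X.left.affineOpens) (b : (a c : ι) → Γ(A.X.left, (U a).1)),
      (⨆ a, (U a).1 = ⊤) ∧ ∀ a c, (U a).1 ⊓ (U c).1 = A.X.left.basicOpen (b a c) :=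
  Morphisms.exists_principal_affine_cover_of_isProjective (pol.isProjective_of_isLocalRing A D Gr hGr₁ hGr₂)

end Polarized

/-! ### §1b The letters' base `Spec (A ⧸ J)`, `A` Artin local -/

section ArtinQuotient

variable (A : Type) [CommRing A] [Algebra ℚ A] [IsArtinianRing A] [IsLocalRing A]

/-- **A polarised abelian scheme over `Spec (A ⧸ J)`, `A` an Artin local `ℚ`-algebra and `J ≠ A`, is projective** (§1: `A ⧸ J` is
again an Artin — hence Noetherian — local `ℚ`-algebra).
[cite: MumfordFogartyKirwan1994, Ch. 6 §3 Prop. 6.15 (p. 124) and its proof (p. 125)] [cite: EGAIII1, Thm. 4.7.1] -/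
theorem isProjective_of_polarization_quotient (J : Ideal A) (hJ : J ≠ ⊤)
    (A₀ : AbelianSchemeOver (Spec (.of (A ⧸ J)))) (D₀ : A₀.DualPair) (pol₀ : A₀.Polarization D₀)
    (Gr₀ : A₀.X.left ⟶ A₀.prodLeft D₀.hat) (hGr₁ : Gr₀ ≫ pullback.fst A₀.X.hom D₀.hat.X.hom = 𝟙 _)
    (hGr₂ : Gr₀ ≫ pullback.snd A₀.X.hom D₀.hat.X.hom = pol₀.lam.left) :
    Morphisms.IsProjective A₀.X.hom := by
  haveI : Nontrivial (A ⧸ J) := Ideal.Quotient.nontrivial_iff.mpr hJ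
  haveI : IsLocalRing (A ⧸ J) := IsLocalRing.of_surjective' (Ideal.Quotient.mk J) Ideal.Quotient.mk_surjective
  exact pol₀.isProjective_of_isLocalRing A₀ D₀ Gr₀ hGr₁ hGr₂

/-- **The G2-P letter's instance**: over `Spec (A ⧸ (t))` with `t ∈ 𝔪_A` (a principal small extension of an Artin local
`ℚ`-algebra), a polarised abelian scheme is projective.
[cite: MumfordFogartyKirwan1994, Ch. 6 §3 Prop. 6.15 (p. 124) and its proof (p. 125)] [cite: EGAIII1, Thm. 4.7.1] -/
theorem isProjective_of_polarization_quotient_span_singleton (t : A) (ht : t ∈ IsLocalRing.maximalIdeal A)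
    (A₀ : AbelianSchemeOver (Spec (.of (A ⧸ Ideal.span {t})))) (D₀ : A₀.DualPair) (pol₀ : A₀.Polarization D₀)
    (Gr₀ : A₀.X.left ⟶ A₀.prodLeft D₀.hat) (hGr₁ : Gr₀ ≫ pullback.fst A₀.X.hom D₀.hat.X.hom = 𝟙 _)
    (hGr₂ : Gr₀ ≫ pullback.snd A₀.X.hom D₀.hat.X.hom = pol₀.lam.left) :
    Morphisms.IsProjective A₀.X.hom :=
  isProjective_of_polarization_quotient A (Ideal.span {t}) (fun h ↦ (IsLocalRing.maximalIdeal.isMaximal A).ne_top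
    (top_le_iff.mp (h ▸ Ideal.span_le.mpr (Set.singleton_subset_iff.mpr ht)))) A₀ D₀ pol₀ Gr₀ hGr₁ hGr₂

/-- **… hence carries a finite principal affine cover** (`U a ∩ U c = D(b_{ac})`), the input of the refinement subordinate to the
trivialising opens of `L^Δ(λ₀)` in MONO-G2. [cite: Hartshorne1977, II Prop. 2.5 (b) and proof (pp. 76–77)]
[cite: MumfordFogartyKirwan1994, Ch. 6 §3 Prop. 6.15 (p. 124) and its proof (p. 125)] -/
theorem exists_principal_affine_cover_of_polarization_quotient (J : Ideal A) (hJ : J ≠ ⊤)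
    (A₀ : AbelianSchemeOver (Spec (.of (A ⧸ J)))) (D₀ : A₀.DualPair) (pol₀ : A₀.Polarization D₀)
    (Gr₀ : A₀.X.left ⟶ A₀.prodLeft D₀.hat) (hGr₁ : Gr₀ ≫ pullback.fst A₀.X.hom D₀.hat.X.hom = 𝟙 _)
    (hGr₂ : Gr₀ ≫ pullback.snd A₀.X.hom D₀.hat.X.hom = pol₀.lam.left) :
    ∃ (ι : Type) (_ : Finite ι) (U : ι → A₀.X.left.affineOpens) (b : (a c : ι) → Γ(A₀.X.left, (U a).1)),
      (⨆ a, (U a).1 = ⊤) ∧ ∀ a c, (U a).1 ⊓ (U c).1 = A₀.X.left.basicOpen (b a c) :=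
  Morphisms.exists_principal_affine_cover_of_isProjective
    (isProjective_of_polarization_quotient A J hJ A₀ D₀ pol₀ Gr₀ hGr₁ hGr₂)

end ArtinQuotient

/-! ## §2 The closed fibre of an abelian scheme and a principal affine cover lifted from it -/

section ClosedFibre

variable {k R : Type u} [Field k] [CommRing R] [Algebra k R] (π : R →ₐ[k] k)

/-- **The closed fibre of an abelian scheme over a `k`-algebra with nilpotent augmentation kernel is projective**: for
`π : R → k` a `k`-algebra retraction, the fibre `A₀ ×_R k → Spec k` of an abelian scheme `A₀ → Spec R` is an abelian variety
over `k`, hence projective ([MumfordAV1970] §6 Application 1, [GortzWedhorn2023] Prop. 27.174 — the tree's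
`AbelianVariety.isProjectiveOver_holds`, read as Hartshorne-projectivity of the structure morphism).
[cite: GortzWedhorn2023, Prop. 27.174 (p. 669)] [cite: Hartshorne1977, II §4 Definition p.103 (projective morphism)] -/
theorem isProjective_baseChange_hom_of_field (A₀ : AbelianSchemeOver (Spec (.of R))) :
    Morphisms.IsProjective (A₀.baseChange (Spec.map (CommRingCat.ofHom π.toRingHom))).X.hom :=
  Morphisms.IsProjective.of_isProjectiveOver
    (AbelianVariety.isProjectiveOver_holds (A₀.fibre (Spec.map (CommRingCat.ofHom π.toRingHom))).toAbelianVariety)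

/-- **The closed fibre of an abelian scheme and a principal affine cover lifted from it** ([Hartshorne2010] Thm. 10.2 (a), proof,
p. 81 / [MumfordFogartyKirwan1994] Ch. 6 §3, p. 125).  For `π : R → k` a `k`-algebra retraction with NILPOTENT kernel and
`A₀ → Spec R` an abelian scheme: the closed fibre `X := A₀ ×_R Spec k` (a smooth `k`-scheme) with the canonical `k`-algebra,
resp. `R`-algebra, structures on the sections of `X`, resp. `A₀`; the cartesian closed immersion `i₀ : X ↪ A₀` over
`Spec k ↪ Spec R`, with nilpotent kernel ideal ([GortzWedhorn2020] Prop. 4.20); a FINITE principal affine cover `(U', b')` of `A₀`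
(`U' j ∩ U' l = D(b'_{jl})`, covering `A₀` — stated both as `IsOpenCover` and as `⨆ j, U' j = ⊤`) whose trace `U j = i₀⁻¹ U' j` on `X` is a principal affine cover `(U, b)` of the
projective `k`-scheme `X` ([Hartshorne1977] II Prop. 2.5; [StacksProject] Tag 06AD: affine opens and principal sections lift
along a nilpotent thickening); the last clause is the body of the `∃`.  Binder order of the MONO-G1 integrator `G1_downstream`.
[cite: Hartshorne2010, Thm. 10.2 (proof), p. 81] [cite: StacksProject, Tag 06AD] [cite: Hartshorne1977, II Prop. 2.5 (b) and proof (pp. 76–77)]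
[cite: GortzWedhorn2020, Prop. 4.20 (p. 104)] [cite: MumfordFogartyKirwan1994, Ch. 6 §3 Prop. 6.15 (p. 124) and its proof (p. 125)] -/
theorem exists_closedFibre_principal_affine_cover (hπnil : IsNilpotent (RingHom.ker π))
    (A₀ : AbelianSchemeOver (Spec (.of R))) :
    ∃ (X : Over (Spec (CommRingCat.of k))) (_ : Smooth X.hom)
      (_ : ∀ W : X.left.Opens, Algebra k Γ(X.left, W))
      (_ : ∀ (W : X.left.Opens) (s : k), algebraMap k Γ(X.left, W) s = (constToPresheaf X).app (op W) s)
      (_ : ∀ W : A₀.X.left.Opens, Algebra R Γ(A₀.X.left, W))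
      (_ : ∀ (W : A₀.X.left.Opens) (a : R), algebraMap R Γ(A₀.X.left, W) a = (constToPresheaf A₀.X).app (op W) a)
      (i₀ : X.left ⟶ A₀.X.left) (_ : IsPullback i₀ X.hom A₀.X.hom (Spec.map (CommRingCat.ofHom π.toRingHom)))
      (_ : IsClosedImmersion i₀) (_ : IsNilpotent i₀.ker)
      (ι : Type u) (_ : Finite ι) (U' : ι → A₀.X.left.affineOpens) (b' : (j l : ι) → Γ(A₀.X.left, (U' j).1))
      (_ : ∀ j l, (U' j).1 ⊓ (U' l).1 = A₀.X.left.basicOpen (b' j l)) (_ : IsOpenCover fun j => (U' j).1)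
      (_ : ⨆ j, (U' j).1 = ⊤)
      (U : ι → X.left.affineOpens) (_ : ∀ j, (U j).1 = i₀ ⁻¹ᵁ (U' j).1)
      (b : (j l : ι) → Γ(X.left, (U j).1)), ∀ j l, (U j).1 ⊓ (U l).1 = X.left.basicOpen (b j l) := by
  -- the closed fibre `X := A₀ ×_R Spec k` and the cartesian square of `i₀ := pr₁`
  let s : Spec (.of k) ⟶ Spec (.of R) := Spec.map (CommRingCat.ofHom π.toRingHom)
  let X : Over (Spec (.of k)) := (A₀.baseChange s).X
  have hXs : Smooth X.hom := (A₀.baseChange s).isSmooth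
  let i₀ : X.left ⟶ A₀.X.left := pullback.fst A₀.X.hom s
  have hi₀ : IsPullback i₀ X.hom A₀.X.hom s := IsPullback.of_hasPullback A₀.X.hom s
  -- a finite principal affine cover of the projective `k`-scheme `X` (an abelian variety)
  obtain ⟨ι, hι, U, b, hcov, hb⟩ :=
    Morphisms.exists_principal_affine_cover_of_isProjective (isProjective_baseChange_hom_of_field π A₀)
  -- `i₀` is a closed immersion with nilpotent kernel ideal (base change of `Spec k ↪ Spec R`)
  have hsurj : Function.Surjective π.toRingHom := fun x ↦ ⟨algebraMap k R x, π.commutes x⟩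
  haveI : IsClosedImmersion i₀ :=
    MorphismProperty.of_isPullback hi₀.flip (IsClosedImmersion.spec_of_surjective _ hsurj)
  have hnil : IsNilpotent i₀.ker := Morphisms.isNilpotent_ker_of_isPullback_specMap π.toRingHom hsurj hπnil hi₀
  -- lift the cover to `A₀` along the nilpotent thickening `i₀`; the lift covers
  obtain ⟨U', b', hU', hb'⟩ := Morphisms.exists_principal_affine_cover_lift i₀ hnil U b hb
  have hU'cov : ⨆ j, (U' j).1 = ⊤ := by
    refine Morphisms.preimage_injective_of_isNilpotent_ker i₀ hnil ?_
    rw [Scheme.Hom.preimage_iSup, Scheme.Hom.preimage_top]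
    simp_rw [hU']
    exact hcov
  exact ⟨X, hXs, fun W ↦ ((constToPresheaf X).app (op W)).hom.toAlgebra, fun W c ↦ rfl,
    fun W ↦ ((constToPresheaf A₀.X).app (op W)).hom.toAlgebra, fun W a ↦ rfl, i₀, hi₀, inferInstance, hnil,
    ι, hι, U', b', hb', hU'cov, hU'cov, U, fun j ↦ (hU' j).symm, b, hb⟩

end ClosedFibre

end AbelianSchemeOver

end Literature.AlgebraicGeometry.AbelianSchemes

end
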